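import Mathlib
import HarnessLib
import Summits.ResolutionOfSingularities.ResolutionOfSingularities.Theorems.WildQuotientsWildQuotientResolutionS1aTriangularKillsIn
import Summits.ResolutionOfSingularities.ResolutionOfSingularities.Theorems.WildQuotientsWildQuotientResolutionS1aGraphShear
import Summits.ResolutionOfSingularities.ResolutionOfSingularities.Theorems.WildQuotientsWildQuotientResolutionS1aTaylor2

/-!
# S1a — R4e, the `r = 0` corner: a graph tail WITHOUT critical points is a ONE-SHOT kill (`graphTail_killsIn_one_of_noCritical`)

[OURS · L1 W4.5c · lead-1 g17; plan-1 RULING R-F15s (2) «state the class theorem with `(hr : 0 < r)`; file r = 0 SEPARATELY as a ONE-move theorem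
`graphTail_killsIn_one_of_noCritical` (g′ = C c a unit ⇒ S = V(x₀, t) is the kill centre itself …)»: after the graph recoordination `x₂′ = t = x₂ − g(x₁)`
(✓`FreeModel.exists_elemShear`) the datum `σ: x₁ ↦ x₁ + x₀, x₂′ ↦ x₂′ − (g(x₁ + x₀) − g(x₁)) = x₂′ − c·x₀ − x₀²·R, x₃ ↦ x₃ + x₂′` is TRIANGULAR for the centre
`(x₀ : 2, x₂′ : 1)` (chains `u = x₂′` with unit `−c`, and `u = x₃`), so ✓`triangular_killsIn_one` applies. In characteristic `p` the hypothesis `g′ = C c` allows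
`g = c·X + h(X^p)` — a genuinely non-linear instance beyond the content range `deg g ≤ p − 2` (Taylor remainder ✓`FreeModel.exists_map_eval₂_eq_of_shift`)] —
NOT statements of the manuscript; counted 0; AI-level work, weaker than expert review. Crux stmt-ResolutionOfSingularities-17941 `CyclicQuotientFourfolds`, line
`s1a-logminvertex` v13 (`stub_reachLowerInFX`).
-/

set_option linter.dupNamespace false

noncomputable section

open CategoryTheory Limits AlgebraicGeometry TopologicalSpace Topology Opposite MvPolynomial
open Literature.AlgebraicGeometry.Resolution Literature.AlgebraicGeometry.RelativeSpec
open Summit.ResolutionOfSingularities.ResolutionOfSingularities.Theorems.WildQuotientResolution.S1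
open Summit.ResolutionOfSingularities.ResolutionOfSingularities.Theorems.WildQuotientResolution.S1.NodeAtlas
open Summit.ResolutionOfSingularities.ResolutionOfSingularities.Theorems.WildQuotientResolution.S1.KillCert
open Summit.ResolutionOfSingularities.ResolutionOfSingularities.Theorems.WildQuotientResolution.S1.GoodCharts
open Summit.ResolutionOfSingularities.ResolutionOfSingularities.Theorems.WildQuotientResolution.S1.NpFrame

namespace Summit.ResolutionOfSingularities.ResolutionOfSingularities.Theorems.WildQuotientResolution.S1.GameFrame.GModel

variable {p : ℕ} {X' X₁ : Scheme.{0}} {q : X' ⟶ X₁} {G : Type} [Group G] {ρ : G →* Aut X'} {g₀ : G}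

/-- **Taylor to second order along `x₀` for `g(x₁)`**: `g(x₁ + x₀) = g(x₁) + x₀·g′(x₁) + x₀²·R` in `k[x₀,…,x₃]`. [folklore] -/
theorem exists_aeval_add_eq_taylor {k : Type} [Field k] (g : Polynomial k) :
    ∃ R : MvPolynomial (Fin 4) k, Polynomial.aeval (X 1 + X 0 : MvPolynomial (Fin 4) k) g =
      Polynomial.aeval (X 1 : MvPolynomial (Fin 4) k) g + X 0 * Polynomial.aeval (X 1 : MvPolynomial (Fin 4) k) (Polynomial.derivative g) + X 0 ^ 2 * R := by
  -- the shift `x₁ ↦ x₁ + x₀` as a ring hom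
  let τ : MvPolynomial (Fin 4) k →+* MvPolynomial (Fin 4) k := (aeval (Function.update (X : Fin 4 → MvPolynomial (Fin 4) k) 1 (X 1 + X 0))).toRingHom
  have hτ1 : τ (X 1) = X 1 + X 0 := by
    change aeval _ (X 1 : MvPolynomial (Fin 4) k) = _; rw [aeval_X, Function.update_self]
  have hτj : ∀ j : Fin 4, j ≠ 1 → τ (X j) = X j := fun j hj => by
    change aeval _ (X j : MvPolynomial (Fin 4) k) = _; rw [aeval_X, Function.update_of_ne hj]
  have hτC : ∀ a : k, τ (C a) = C a := fun a => by change aeval _ (C a : MvPolynomial (Fin 4) k) = _; rw [aeval_C]; rfl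
  obtain ⟨R, hR⟩ := FreeModel.exists_map_eval₂_eq_of_shift (C : k →+* MvPolynomial (Fin 4) k) (X : Fin 4 → MvPolynomial (Fin 4) k) 1 (X 0) τ hτC
    (by rw [hτ1]) (fun j hj => hτj j hj) (Polynomial.aeval (X 1 : MvPolynomial (Fin 4) k) g)
  refine ⟨R, ?_⟩
  rw [MvPolynomial.eval₂_eta] at hR
  have hτg : τ (Polynomial.aeval (X 1 : MvPolynomial (Fin 4) k) g) = Polynomial.aeval (X 1 + X 0 : MvPolynomial (Fin 4) k) g := by
    change aeval _ (Polynomial.aeval (X 1 : MvPolynomial (Fin 4) k) g) = _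
    rw [← Polynomial.aeval_algHom_apply, aeval_X, Function.update_self]
  have hd : pderiv 1 (Polynomial.aeval (X 1 : MvPolynomial (Fin 4) k) g) = Polynomial.aeval (X 1 : MvPolynomial (Fin 4) k) (Polynomial.derivative g) := by
    rw [Derivation.map_aeval, pderiv_X_self, smul_eq_mul, mul_one]
  rw [hτg, hd, MvPolynomial.eval₂_eta] at hR
  rw [hR]

/-- ★ **`KillsIn 1` FOR A GRAPH TAIL WITHOUT CRITICAL POINTS** (`g′ = C c`, `c ≠ 0`; R4 normal form `σ: x₁ ↦ x₁ + x₀, x₃ ↦ x₃ + (x₂ − g(x₁))`, `x₀, x₂` and the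
constants fixed): the surface `S = V(x₀, x₂ − g(x₁))` is the kill centre itself. See the module docstring. [OURS · L1 W4.5c · R4e `r = 0` corner; NOT a statement
of the manuscript] -/
theorem graphTail_killsIn_one_of_noCritical [Finite G] (hp : p.Prime) (hG : ∀ g : G, g ∈ Subgroup.zpowers g₀) (hg₀ : g₀ ^ p = 1)
    (hq : ∀ g : G, (ρ g).hom ≫ q = q) [IsIntegral X'] [IsLocallyNoetherian X'] [X'.IsSeparated] [IsAffine X'] [X₁.IsSeparated] [IsFinite q]
    (hreg : Scheme.IsRegular X') {k' : Type} [Field k'] (φ : X₁ ⟶ Spec (.of k')) [LocallyOfFiniteType φ]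
    {k : Type} [Field k] (g : Polynomial k) (c : k) (hc : c ≠ 0) (hg' : Polynomial.derivative g = Polynomial.C c)
    (σ : MvPolynomial (Fin 4) k ≃+* MvPolynomial (Fin 4) k) (hC : ∀ a : k, σ (C a) = C a)
    (h0 : σ (X 0) = X 0) (h1 : σ (X 1) = X 1 + X 0) (h2 : σ (X 2) = X 2) (h3 : σ (X 3) = X 3 + (X 2 - Polynomial.aeval (X 1 : MvPolynomial (Fin 4) k) g))
    (e : Γ(X', ⊤) ≃+* MvPolynomial (Fin 4) k)
    (hστ : ∀ t : Γ(X', ⊤), e ((ρ g₀⁻¹).hom.appLE ⊤ ⊤ (by rw [Scheme.Hom.preimage_top]) t) = σ (e t))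
    (h₀ : NodeAtlas p (⟨ρ, hq⟩ : ActionOver q G) g₀) :
    KillsIn 1 (GModel.initial (p := p) (g₀ := g₀) hq h₀) := by
  classical
  -- the graph recoordination `γ : x₂ ↦ x₂ + g(x₁)` (new coordinate `x₂′ = γ⁻¹ x₂ = x₂ − g(x₁)`)
  obtain ⟨α', hα2, hα, hα2', hα'⟩ := FreeModel.exists_elemShear k (2 : Fin 4) (Polynomial.aeval (X 1 : MvPolynomial (Fin 4) k) g)
    (fun f hf => by rw [← Polynomial.aeval_algHom_apply, aeval_X, hf 1 (by decide)])
  let γ : MvPolynomial (Fin 4) k ≃ₐ[k] MvPolynomial (Fin 4) k := α'.symm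
  have hγ2 : γ (X 2) = X 2 + Polynomial.aeval (X 1 : MvPolynomial (Fin 4) k) g := hα2'
  have hγ : ∀ l : Fin 4, l ≠ 2 → γ (X l) = X l := hα'
  have hγs2 : γ.symm (X 2) = X 2 - Polynomial.aeval (X 1 : MvPolynomial (Fin 4) k) g := by change α'.symm.symm (X 2) = _; rw [α'.symm_symm]; exact hα2
  have hγs : ∀ l : Fin 4, l ≠ 2 → γ.symm (X l) = X l := fun l hl => by change α'.symm.symm (X l) = _; rw [α'.symm_symm]; exact hα l hl
  have hγg : ∀ x : MvPolynomial (Fin 4) k, γ (Polynomial.aeval x g) = Polynomial.aeval (γ x) g := fun x => by rw [← Polynomial.aeval_algHom_apply]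
  have hσg : ∀ x : MvPolynomial (Fin 4) k, σ (Polynomial.aeval x g) = Polynomial.aeval (σ x) g := fun x => by
    have hcomp : (σ : MvPolynomial (Fin 4) k →+* MvPolynomial (Fin 4) k).comp (algebraMap k (MvPolynomial (Fin 4) k)) = algebraMap k (MvPolynomial (Fin 4) k) :=
      RingHom.ext fun a => by rw [RingHom.comp_apply, MvPolynomial.algebraMap_eq, RingHom.coe_coe, hC]
    rw [Polynomial.aeval_def, Polynomial.aeval_def]
    have h := Polynomial.hom_eval₂ g (algebraMap k (MvPolynomial (Fin 4) k)) (σ : MvPolynomial (Fin 4) k →+* MvPolynomial (Fin 4) k) x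
    rw [hcomp] at h
    exact h
  obtain ⟨R, hR⟩ := exists_aeval_add_eq_taylor (k := k) g
  rw [hg', Polynomial.aeval_C, MvPolynomial.algebraMap_eq] at hR
  -- the conjugate `σ′ = γ σ γ⁻¹`
  let σ' : MvPolynomial (Fin 4) k ≃+* MvPolynomial (Fin 4) k := (γ.symm.toRingEquiv.trans σ).trans γ.toRingEquiv
  have hσ' : ∀ x, σ' x = γ (σ (γ.symm x)) := fun _ => rfl
  have hC' : ∀ a : k, σ' (C a) = C a := fun a => by
    rw [hσ', show γ.symm (C a) = C a from γ.symm.commutes a, hC, show γ (C a) = C a from γ.commutes a]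
  have hinc0 : σ' (X 0) - X 0 = 0 := by rw [hσ', hγs 0 (by decide), h0, hγ 0 (by decide), sub_self]
  have hinc1 : σ' (X 1) - X 1 = X 0 := by rw [hσ', hγs 1 (by decide), h1, map_add, hγ 1 (by decide), hγ 0 (by decide)]; ring
  have hinc2 : σ' (X 2) - X 2 = -(X 0 * C c + X 0 ^ 2 * R) := by
    rw [hσ', hγs2, map_sub, h2, hσg, h1, map_sub, hγ2, hγg, map_add, hγ 1 (by decide), hγ 0 (by decide), hR]; ring
  have hinc3 : σ' (X 3) - X 3 = X 2 := by
    rw [hσ', hγs 3 (by decide), h3, map_add, map_sub, hγ 3 (by decide), hγ2, hγg, hγ 1 (by decide)]; ring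
  let e' : Γ(X', ⊤) ≃+* MvPolynomial (Fin 4) k := e.trans γ.toRingEquiv
  have hστ' : ∀ t : Γ(X', ⊤), e' ((ρ g₀⁻¹).hom.appLE ⊤ ⊤ (by rw [Scheme.Hom.preimage_top]) t) = σ' (e' t) := fun t => by
    change γ (e _) = γ (σ (γ.symm (γ (e t))))
    rw [hστ, γ.symm_apply_apply]
  -- the triangular datum: centre `(x₀ : 2, x₂′ : 1)`
  let v : Fin 2 → Fin 4 := ![0, 2]
  let w : Fin 2 → ℕ := ![2, 1]
  have hv : Function.Injective v := by decide
  have hX0 : (X 0 : MvPolynomial (Fin 4) k) ∈ (weightedFiltration (X ∘ v : Fin 2 → MvPolynomial (Fin 4) k) w).ideal 2 :=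
    mem_weightedFiltration_ideal (X ∘ v : Fin 2 → MvPolynomial (Fin 4) k) w 0
  have hX2 : (X 2 : MvPolynomial (Fin 4) k) ∈ (weightedFiltration (X ∘ v : Fin 2 → MvPolynomial (Fin 4) k) w).ideal 1 :=
    mem_weightedFiltration_ideal (X ∘ v : Fin 2 → MvPolynomial (Fin 4) k) w 1
  have hX0' : (X 0 : MvPolynomial (Fin 4) k) ∈ (weightedFiltration (X ∘ v : Fin 2 → MvPolynomial (Fin 4) k) w).ideal 1 :=
    (weightedFiltration _ w).antitone (by norm_num : 1 ≤ 2) hX0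
  have hX00 : (X 0 ^ 2 : MvPolynomial (Fin 4) k) ∈ (weightedFiltration (X ∘ v : Fin 2 → MvPolynomial (Fin 4) k) w).ideal 4 := by
    rw [pow_two]; exact (weightedFiltration (X ∘ v : Fin 2 → MvPolynomial (Fin 4) k) w).mul_le 2 2 (Ideal.mul_mem_mul hX0 hX0)
  have hrow2 : -(X 0 * C c + X 0 ^ 2 * R : MvPolynomial (Fin 4) k) ∈ (weightedFiltration (X ∘ v : Fin 2 → MvPolynomial (Fin 4) k) w).ideal 2 :=
    neg_mem (add_mem (Ideal.mul_mem_right _ _ hX0) (Ideal.mul_mem_right _ _ ((weightedFiltration _ w).antitone (by norm_num : 2 ≤ 4) hX00)))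
  refine triangular_killsIn_one hp hG hg₀ hq hreg φ σ' hC' (by norm_num : 0 < 2) v hv w (fun l => by fin_cases l <;> decide) ?_ ?_ ?_ ?_ e' hστ' h₀
  · intro i
    fin_cases i
    · change σ' (X 0) - X 0 ∈ _
      rw [hinc0]; exact Ideal.zero_mem _
    · change σ' (X 1) - X 1 ∈ _
      rw [hinc1]; exact hX0'
    · change σ' (X 2) - X 2 ∈ _
      rw [hinc2]; exact (weightedFiltration _ w).antitone (by norm_num : 1 ≤ 2) hrow2
    · change σ' (X 3) - X 3 ∈ _
      rw [hinc3]; exact hX2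
  · intro l
    fin_cases l
    · change σ' (X 0) - X 0 ∈ _
      rw [hinc0]; exact Ideal.zero_mem _
    · change σ' (X 2) - X 2 ∈ (weightedFiltration (X ∘ v : Fin 2 → MvPolynomial (Fin 4) k) w).ideal 2
      rw [hinc2]; exact hrow2
  · refine ⟨1, ?_⟩
    rw [pow_one, Ideal.span_le]
    rintro _ ⟨l, rfl⟩
    fin_cases l
    · change (X 0 : MvPolynomial (Fin 4) k) ∈ _
      rw [← hinc1]; exact sub_mem_augmentationIdeal σ' _
    · change (X 2 : MvPolynomial (Fin 4) k) ∈ _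
      rw [← hinc3]; exact sub_mem_augmentationIdeal σ' _
  · intro l
    fin_cases l
    · refine ⟨X 2, -C c, (isUnit_iff_ne_zero.mpr hc).map C |>.neg, hX2, ?_⟩
      change σ' (X 2) - X 2 - -C c * X 0 ∈ (weightedFiltration (X ∘ v : Fin 2 → MvPolynomial (Fin 4) k) w).ideal 3
      rw [hinc2, show -(X 0 * C c + X 0 ^ 2 * R) - -C c * X 0 = -(X 0 ^ 2 * R : MvPolynomial (Fin 4) k) by ring]
      exact neg_mem (Ideal.mul_mem_right _ _ ((weightedFiltration _ w).antitone (by norm_num : 3 ≤ 4) hX00))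
    · refine ⟨X 3, 1, isUnit_one, ?_, ?_⟩
      · change (X 3 : MvPolynomial (Fin 4) k) ∈ (weightedFiltration (X ∘ v : Fin 2 → MvPolynomial (Fin 4) k) w).ideal 0
        exact mem_weightedFiltration_zero _ w _
      change σ' (X 3) - X 3 - 1 * X 2 ∈ _
      rw [hinc3, one_mul, sub_self]; exact Ideal.zero_mem _

end Summit.ResolutionOfSingularities.ResolutionOfSingularities.Theorems.WildQuotientResolution.S1.GameFrame.GModel

end
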